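/-
Copyright: harness cell b2b-lgcu-borel (gen 14).  Honest framing: the VALUE here is a THEOREM
(a hypothesis-free packing law + no-go in the decidable cell `(m,k) = (2,1)`) — NOT summit
progress; the crux `SubgroupIdentityDesigns` (stmt-MatrixMultiplication-14079) is open.
-/
import Summits.MatrixMultiplication.MatrixMultiplication.Theorems.SubgroupIdentityDesigns.Negative.Transvections
import Summits.MatrixMultiplication.MatrixMultiplication.Theorems.SubgroupIdentityDesigns.Negative.DecoratedSylowNoGo
import Summits.MatrixMultiplication.MatrixMultiplication.Theorems.SubgroupIdentityDesigns.Negative.StandardLines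

/-!
# The three-Sylow packing law in `GL₂(𝔽_p)` — hypothesis-free

**Theorem (`threeSylow_volume_le`).**  If `(H₁, H₂, H₃)` is a subgroup TPP triple of `GL₂(𝔽_p)`
and `p` divides the order of each member, then `|H₁| |H₂| |H₃| ≤ p³ (p - 1)`.

No Borel / shape hypothesis is assumed (contrast `DecoratedSylowLaw.decoratedSylow_volume_le`,
which this file reduces to).  Proof.  Cauchy gives a transvection `gᵢ ∈ Hᵢ` with fixed line
`ℓᵢ` (`Transvections.exists_transvection`).  Two members whose transvections share a fixed line
both contain the full root group of that line (`upper_le_map_conj`), contradicting the pairwise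
disjointness forced by the TPP (`not_disjoint_of_common_fixed`); so `ℓ₁, ℓ₂, ℓ₃` are distinct,
and a frame `c` with `c e₁ ∈ ℓ₁`, `c e₂ ∈ ℓ₃`, `c (e₁ + e₂) ∈ ℓ₂` conjugates the triple to
`Kᵢ = c⁻¹ Hᵢ c` with `U⁺ ≤ K₁`, `U_{[1:1]} ≤ K₂`, `U⁻ ≤ K₃`.  THE ROOT LEMMA
(`lower_mem_of_upper_mem`: `U_ℓ ≤ L` and `h ∈ L` moving `ℓ` force `U_{hℓ} ≤ L`) then confines
`K₁ ≤ B⁺`, `K₃ ≤ B⁻`, `K₂ ≤ Stab [1:1]` — otherwise some root group would sit in two members —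
and `decoratedSylow_volume_le` gives `|K₁| |K₂| |K₃| ≤ p³ (p - 1)`.

**Corollaries.**  `no_threeSylow_witness`: no such triple is a `(m,k) = (2,1)` witness of
`SubgroupIdentityDesigns` for `0 ≤ ε ≤ 1` (`rpow_volume_le_floor`, `budget_two_ge`; the design
clause is not even used); `exists_coprime_member_of_witness`: every `(2,1)` witness with
`0 ≤ ε ≤ 1` has a member of order prime to `p`.

Report: `run/shared/lean/b2b/levelgraded-cu/ORACLE-g14.md` §G14-2.  Sorry-free; no new definitions.
-/

set_option linter.dupNamespace false

noncomputable section

open scoped BigOperators Classical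
open Summit.MatrixMultiplication.MatrixMultiplication.Theorems.LieRankDesigns.Negative (GLm Mat budget)

namespace Summit.MatrixMultiplication.MatrixMultiplication.Theorems.SubgroupIdentityDesigns.Negative

section ThreeSylowLaw

open Literature.Barriers.MatrixMultiplication (SubgroupTPP)

variable {p : ℕ} [hp : Fact p.Prime]

/-- **THE THREE-SYLOW PACKING LAW (hypothesis-free).**  A subgroup TPP triple of `GL₂(𝔽_p)` all of
whose members have order divisible by `p` has volume `|H₁| |H₂| |H₃| ≤ p³ (p - 1)`. -/
theorem threeSylow_volume_le {H₁ H₂ H₃ : Subgroup (GLm p 2)} (htpp : SubgroupTPP H₁ H₂ H₃)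
    (h₁ : p ∣ Nat.card H₁) (h₂ : p ∣ Nat.card H₂) (h₃ : p ∣ Nat.card H₃) :
    Nat.card H₁ * Nat.card H₂ * Nat.card H₃ ≤ p ^ 3 * (p - 1) := by
  obtain ⟨d12, d13, d23⟩ := StandardLines.subgroupTPP_disjoint htpp
  obtain ⟨g₁, hg₁, hg₁1, hdet₁, v₁, hv₁, hfix₁⟩ := exists_transvection h₁
  obtain ⟨g₂, hg₂, hg₂1, hdet₂, v₂, hv₂, hfix₂⟩ := exists_transvection h₂
  obtain ⟨g₃, hg₃, hg₃1, hdet₃, v₃, hv₃, hfix₃⟩ := exists_transvection h₃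
  -- Step 1: the three fixed lines are pairwise distinct.
  have hD12 : v₁ 0 * v₂ 1 - v₂ 0 * v₁ 1 ≠ 0 := fun hD =>
    not_disjoint_of_common_fixed hg₁ hg₂ hg₁1 hg₂1 hdet₁ hdet₂ hv₂
      (fixed_of_det_eq_zero hv₁ hfix₁.1 hfix₁.2 hD) hfix₂ d12
  have hD13 : v₁ 0 * v₃ 1 - v₃ 0 * v₁ 1 ≠ 0 := fun hD =>
    not_disjoint_of_common_fixed hg₁ hg₃ hg₁1 hg₃1 hdet₁ hdet₃ hv₃
      (fixed_of_det_eq_zero hv₁ hfix₁.1 hfix₁.2 hD) hfix₃ d13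
  have hD23 : v₂ 0 * v₃ 1 - v₃ 0 * v₂ 1 ≠ 0 := fun hD =>
    not_disjoint_of_common_fixed hg₂ hg₃ hg₂1 hg₃1 hdet₂ hdet₃ hv₃
      (fixed_of_det_eq_zero hv₂ hfix₂.1 hfix₂.2 hD) hfix₃ d23
  -- Step 2: the frame `c = (α v₁ | β v₃)` with `α v₁ + β v₃ = v₂`.
  obtain ⟨α, hα⟩ : ∃ α : ZMod p, α = (v₂ 0 * v₃ 1 - v₃ 0 * v₂ 1) / (v₁ 0 * v₃ 1 - v₃ 0 * v₁ 1) :=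
    ⟨_, rfl⟩
  obtain ⟨β, hβ⟩ : ∃ β : ZMod p, β = (v₁ 0 * v₂ 1 - v₂ 0 * v₁ 1) / (v₁ 0 * v₃ 1 - v₃ 0 * v₁ 1) :=
    ⟨_, rfl⟩
  have hα0 : α ≠ 0 := hα ▸ div_ne_zero hD23 hD13
  have hβ0 : β ≠ 0 := hβ ▸ div_ne_zero hD12 hD13
  have hsum0 : α * v₁ 0 + β * v₃ 0 = v₂ 0 := by
    rw [hα, hβ, div_mul_eq_mul_div, div_mul_eq_mul_div, ← add_div, div_eq_iff hD13]
    ring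
  have hsum1 : α * v₁ 1 + β * v₃ 1 = v₂ 1 := by
    rw [hα, hβ, div_mul_eq_mul_div, div_mul_eq_mul_div, ← add_div, div_eq_iff hD13]
    ring
  obtain ⟨c, c00, c01, c10, c11⟩ :=
    exists_gl2 (α * v₁ 0) (β * v₃ 0) (α * v₁ 1) (β * v₃ 1) (by
      have e : α * v₁ 0 * (β * v₃ 1) - β * v₃ 0 * (α * v₁ 1) =
          α * β * (v₁ 0 * v₃ 1 - v₃ 0 * v₁ 1) := by ring
      rw [e]
      exact mul_ne_zero (mul_ne_zero hα0 hβ0) hD13)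
  obtain ⟨m, m00, m01, m10, m11⟩ := exists_gl2 (1 : ZMod p) 0 1 1 (by simp)
  obtain ⟨w, w00, w01, w10, w11⟩ := exists_gl2 (0 : ZMod p) 1 1 0 (by simp)
  -- Step 3: `U⁺ ≤ c⁻¹ H₁ c`, `U⁺ ≤ (c m)⁻¹ H₂ (c m)`, `U⁺ ≤ (c w)⁻¹ H₃ (c w)`.
  have hL₁ := upper_le_map_conj (z := c) hg₁ hg₁1 hdet₁
    (by rw [c00, c10]; linear_combination α * hfix₁.1)
    (by rw [c00, c10]; linear_combination α * hfix₁.2)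
  have hcm0 : ((c * m : GLm p 2) : Mat p 2) 0 0 = v₂ 0 := by
    rw [gl2_mul_apply, c00, c01, m00, m10, mul_one, mul_one, hsum0]
  have hcm1 : ((c * m : GLm p 2) : Mat p 2) 1 0 = v₂ 1 := by
    rw [gl2_mul_apply, c10, c11, m00, m10, mul_one, mul_one, hsum1]
  have hL₂ := upper_le_map_conj (z := c * m) hg₂ hg₂1 hdet₂
    (by rw [hcm0, hcm1]; exact hfix₂.1) (by rw [hcm0, hcm1]; exact hfix₂.2)
  have hcw0 : ((c * w : GLm p 2) : Mat p 2) 0 0 = β * v₃ 0 := by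
    rw [gl2_mul_apply, c00, c01, w00, w10]; ring
  have hcw1 : ((c * w : GLm p 2) : Mat p 2) 1 0 = β * v₃ 1 := by
    rw [gl2_mul_apply, c10, c11, w00, w10]; ring
  have hL₃ := upper_le_map_conj (z := c * w) hg₃ hg₃1 hdet₃
    (by rw [hcw0, hcw1]; linear_combination β * hfix₃.1)
    (by rw [hcw0, hcw1]; linear_combination β * hfix₃.2)
  -- Transfer between the frames `c m`, `c w` and `c`.
  have movm : ∀ {H : Subgroup (GLm p 2)} {x : GLm p 2},
      (m⁻¹ * x * m ∈ H.map (MulAut.conj (c * m)⁻¹).toMonoidHom ↔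
        x ∈ H.map (MulAut.conj c⁻¹).toMonoidHom) := by
    intro H x
    rw [mem_map_conj_inv_iff, mem_map_conj_inv_iff]
    have e : c * m * (m⁻¹ * x * m) * (c * m)⁻¹ = c * x * c⁻¹ := by group
    rw [e]
  have movw : ∀ {H : Subgroup (GLm p 2)} {x : GLm p 2},
      (w⁻¹ * x * w ∈ H.map (MulAut.conj (c * w)⁻¹).toMonoidHom ↔
        x ∈ H.map (MulAut.conj c⁻¹).toMonoidHom) := by
    intro H x
    rw [mem_map_conj_inv_iff, mem_map_conj_inv_iff]
    have e : c * w * (w⁻¹ * x * w) * (c * w)⁻¹ = c * x * c⁻¹ := by group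
    rw [e]
  -- Step 4: the conjugated triple `Kᵢ = c⁻¹ Hᵢ c` and its unipotent subgroups.
  have htppK : SubgroupTPP (H₁.map (MulAut.conj c⁻¹).toMonoidHom)
      (H₂.map (MulAut.conj c⁻¹).toMonoidHom) (H₃.map (MulAut.conj c⁻¹).toMonoidHom) :=
    subgroupTPP_map_of_injective _ (MulAut.conj c⁻¹).injective htpp
  obtain ⟨-, dK13, dK23⟩ := StandardLines.subgroupTPP_disjoint htppK
  have hU₁ : ∀ u : GLm p 2, (u : Mat p 2) 1 0 = 0 → (u : Mat p 2) 0 0 = 1 → (u : Mat p 2) 1 1 = 1 →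
      u ∈ H₁.map (MulAut.conj c⁻¹).toMonoidHom := hL₁
  have hU₂ : ∀ u : GLm p 2, (u : Mat p 2) 0 0 + (u : Mat p 2) 0 1 = (u : Mat p 2) 1 0 +
      (u : Mat p 2) 1 1 → (u : Mat p 2) 0 0 + (u : Mat p 2) 0 1 = 1 →
      (u : Mat p 2) 1 1 - (u : Mat p 2) 0 1 = 1 → u ∈ H₂.map (MulAut.conj c⁻¹).toMonoidHom := by
    intro u hs h1 h2
    obtain ⟨e00, -, e10, e11⟩ := conj_m_apply m00 m01 m10 m11 u
    exact movm.1 (hL₂ _ (by rw [e10, ← hs, sub_self]) (by rw [e00, h1]) (by rw [e11, h2]))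
  have hU₃ : ∀ u : GLm p 2, (u : Mat p 2) 0 1 = 0 → (u : Mat p 2) 0 0 = 1 → (u : Mat p 2) 1 1 = 1 →
      u ∈ H₃.map (MulAut.conj c⁻¹).toMonoidHom := by
    intro u h01 h00 h11
    obtain ⟨e00, -, e10, e11⟩ := conj_w_apply w00 w01 w10 w11 u
    exact movw.1 (hL₃ _ (by rw [e10, h01]) (by rw [e00, h11]) (by rw [e11, h00]))
  -- Two test unipotents `E₁₂(1)`, `E₂₁(1)`.
  obtain ⟨uU, uU00, uU01, uU10, uU11⟩ := exists_gl2 (1 : ZMod p) 1 0 1 (by simp)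
  obtain ⟨uL, uL00, uL01, uL10, uL11⟩ := exists_gl2 (1 : ZMod p) 0 1 1 (by simp)
  have huU1 : uU ≠ 1 := fun h =>
    one_ne_zero (by rw [← uU01, h]; exact (gl2_one_apply (p := p)).2.1)
  have huL1 : uL ≠ 1 := fun h =>
    one_ne_zero (by rw [← uL10, h]; exact (gl2_one_apply (p := p)).2.2.1)
  have huU₁ := hU₁ uU uU10 uU00 uU11
  have huL₃ := hU₃ uL uL01 uL00 uL11
  -- Step 5: Borel containments, by the root lemma and disjointness.
  have hB₁ : ∀ h ∈ H₁.map (MulAut.conj c⁻¹).toMonoidHom, (h : Mat p 2) 1 0 = 0 := by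
    intro h hh
    by_contra hne
    exact huL1 (Subgroup.disjoint_def.1 dK13
      (lower_mem_of_upper_mem hU₁ hh hne uL uL01 uL00 uL11) huL₃)
  have hB₃ : ∀ h ∈ H₃.map (MulAut.conj c⁻¹).toMonoidHom, (h : Mat p 2) 0 1 = 0 := by
    intro h hh
    by_contra hne
    obtain ⟨-, -, e10, -⟩ := conj_w_apply w00 w01 w10 w11 h
    have hlow := lower_mem_of_upper_mem hL₃ (movw.2 hh) (by rw [e10]; exact hne)
    obtain ⟨f00, f01, -, f11⟩ := conj_w_apply w00 w01 w10 w11 uU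
    have huU₃ := movw.1 (hlow (w⁻¹ * uU * w) (by rw [f01, uU10]) (by rw [f00, uU11])
      (by rw [f11, uU00]))
    exact huU1 (Subgroup.disjoint_def.1 dK13 huU₁ huU₃)
  have hB₂ : ∀ h ∈ H₂.map (MulAut.conj c⁻¹).toMonoidHom,
      (h : Mat p 2) 0 0 + (h : Mat p 2) 0 1 = (h : Mat p 2) 1 0 + (h : Mat p 2) 1 1 := by
    intro h hh
    by_contra hne
    obtain ⟨-, -, e10, -⟩ := conj_m_apply m00 m01 m10 m11 h
    have hlow := lower_mem_of_upper_mem hL₂ (movm.2 hh)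
      (by rw [e10]; exact sub_ne_zero.2 (Ne.symm hne))
    obtain ⟨f00, f01, -, f11⟩ := conj_m_apply m00 m01 m10 m11 uL
    have huL₂ := movm.1 (hlow (m⁻¹ * uL * m) (by rw [f01, uL01])
      (by rw [f00, uL00, uL01, add_zero]) (by rw [f11, uL11, uL01, sub_zero]))
    exact huL1 (Subgroup.disjoint_def.1 dK23 huL₂ huL₃)
  -- Step 6: the decorated-Sylow law for the conjugated triple.
  have hV := decoratedSylow_volume_le hB₁ hU₁ hB₂ hU₂ hB₃ hU₃ htppK
  rwa [Subgroup.card_map_of_injective (MulAut.conj c⁻¹).injective,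
    Subgroup.card_map_of_injective (MulAut.conj c⁻¹).injective,
    Subgroup.card_map_of_injective (MulAut.conj c⁻¹).injective] at hV

/-- **No-go (three members of order divisible by `p`).**  For `0 ≤ ε ≤ 1` no subgroup TPP triple of
`GL₂(𝔽_p)` with `p ∣ |Hᵢ|` (`i = 1,2,3`) beats the level-`1` character budget of `GL₂(𝔽_p)`:
such triples are never `(m,k) = (2,1)` witnesses of `SubgroupIdentityDesigns`. -/
theorem no_threeSylow_witness {ε : ℝ} (hε0 : 0 ≤ ε) (hε1 : ε ≤ 1)
    {H₁ H₂ H₃ : Subgroup (GLm p 2)} (htpp : SubgroupTPP H₁ H₂ H₃)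
    (h₁ : p ∣ Nat.card H₁) (h₂ : p ∣ Nat.card H₂) (h₃ : p ∣ Nat.card H₃) :
    ¬ budget p 2 1 (2 + ε) <
      ((Nat.card H₁ * Nat.card H₂ * Nat.card H₃ : ℕ) : ℝ) ^ ((2 + ε) / 3) := by
  have hV := threeSylow_volume_le htpp h₁ h₂ h₃
  have h := rpow_volume_le_floor (p := p) hV (s := 2 + ε) (by linarith) (by linarith)
  exact not_lt.2 (h.trans (budget_two_ge (2 + ε)))

/-- **Dichotomy.**  Every `(m,k) = (2,1)` witness of `SubgroupIdentityDesigns` with `0 ≤ ε ≤ 1`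
has a member of order prime to `p` (the design clause is not needed for this). -/
theorem exists_coprime_member_of_witness {ε : ℝ} (hε0 : 0 ≤ ε) (hε1 : ε ≤ 1)
    {H₁ H₂ H₃ : Subgroup (GLm p 2)} (htpp : SubgroupTPP H₁ H₂ H₃)
    (hlt : budget p 2 1 (2 + ε) <
      ((Nat.card H₁ * Nat.card H₂ * Nat.card H₃ : ℕ) : ℝ) ^ ((2 + ε) / 3)) :
    ¬ p ∣ Nat.card H₁ ∨ ¬ p ∣ Nat.card H₂ ∨ ¬ p ∣ Nat.card H₃ := by
  by_contra h
  push Not at h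
  exact no_threeSylow_witness hε0 hε1 htpp h.1 h.2.1 h.2.2 hlt

end ThreeSylowLaw

end Summit.MatrixMultiplication.MatrixMultiplication.Theorems.SubgroupIdentityDesigns.Negative
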